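import Summits.QuantumFields.YangMills.Theorems.ColdStartUniversalityLatticeLangevinLezaudBernstein
import HarnessLib

/-!
# Route `ColdStartUniversality` (fixed-cut-off SZZ dynamics, sampler statistics): LEZAUD'S CHERNOFF BOUND IN CONTINUOUS TIME FROM A GAP AND
# A WARM START — the abstract form (any realising kernel family, any `L²` gap `λ`, any `L²`-warm time `a`), so that every gap constant plugs in

Helper file (seat `ym-line-csu-p1`, g37; `--supports stmt-QuantumFields-24809`).  SU(2) lattice Langevin dynamics of Shen–Zhu–Zhu at `(L, β')`,
Wilson measure `μ = μ_{β'}`.  `…LezaudBernstein` carried out the `h → 0` limit of the discrete Feynman–Kac bound only at `|β'| < 1/12` with the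
Bakry–Émery gap `1 − 12|β'|` and the hypercontractive warm start.  Here the SAME limit argument is run with the gap `λ` and the warm-start
constant `D` as HYPOTHESES (exactly those of `integral_exp_skeleton_sum_le`), for a centred bounded continuous potential `V`:

* ★★★ `integral_exp_timeIntegral_le_of_gap_of_warm` — if `∫ (κ_t G − μG)² dμ ≤ e^{−2λt} Var_μ(G)` for all bounded measurable `G` and the law of
  `U_a` is `L²`-warm (`|E φ(U_a)| ≤ D‖φ‖_{L²(μ)}`), then for `V` continuous, `|V| ≤ b`, `μV = 0`, `∫V² dμ ≤ σ²`, `0 ≤ θ`, `θb < λ`, `T > 0`: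
  `E exp(θ ∫_{(0,T]} V(U_{a+r}) dr) ≤ D · exp(T·θ²σ²/(λ − θb))` (and the functional is integrable);
* ★★★ `timeIntegral_tail_le_of_gap_of_warm` — `P[ T⁻¹∫_{(0,T]} V(U_{a+r}) dr ≥ ε ] ≤ D · exp(−λTε²/(4σ² + 2bε))`.

Instances: `λ = 1 − 12|β'|`, `D = e`, `a = 2 + t₀ + u` (`…LezaudBernstein`); `λ = (3/2)e^{−4|β'|#𝒫}` (Holley–Stroock) at EVERY `(L, β')` (sequel);
and — conditionally — any K-UNIFORM gap in physical units would give K-uniform exponential concentration of physical-time averages.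
[cite: Lezaud2001, Theorem 1.1 and Remark 1.2].  THEOREMS ONLY, no definition, no sorry.  HONEST FRAMING: RECORD-rung R3 plumbing at FIXED cut-off;
`λ`, `D` are hypotheses; nothing K-uniform is proved; no crux, rung or summit statement is proved; the Yang–Mills mass gap is NOT proved.
-/

set_option autoImplicit false

noncomputable section

namespace Summit.QuantumFields.YangMills.Theorems.ColdStartUniversality

open MeasureTheory ProbabilityTheory Filter Set Topology
open scoped BigOperators NNReal ENNReal
open Literature.Probability.Process Literature.MathematicalPhysics.QuantumFieldTheory
open Literature.MathematicalPhysics.QuantumLattice (fundamentalRep fundamentalLatticeRep continuous_fundamentalRep)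

variable {L : ℕ} [NeZero L]

/-- ★★★ **LEZAUD'S EXPONENTIAL MOMENT BOUND IN CONTINUOUS TIME FROM A GAP AND A WARM START (abstract form).**  Let `κ` be a realising
Markov kernel family of the SU(2) SZZ dynamics at `(L, β')` with the `L²(μ_{β'})` gap `λ > 0` on bounded measurable observables, `U` a strong
solution from a deterministic start on ANY filtered probability space whose law at the lattice time `a` is `L²`-warm with constant `D ≥ 0`
(`|∫ φ(U_a) dP| ≤ D (∫ φ² dμ)^{1/2}` for all bounded measurable `φ`), and `V` a CONTINUOUS potential with `|V| ≤ b`, `∫ V dμ = 0`,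
`∫ V² dμ ≤ σ²` (`σ > 0`).  Then for every `0 ≤ θ` with `θb < λ` and every `T > 0` the functional `exp(θ∫_{(0,T]} V(U_{a+r}) dr)` is integrable
and  `∫ exp(θ ∫_{(0,T]} V(U_{a+r}) dr) dP ≤ D · exp(T · θ²σ²/(λ − θb))`
(`h = T/(n+1) → 0` in `integral_exp_skeleton_sum_le`: a.s. continuous paths, left Riemann sums, dominated convergence, `lezaud_rate_bound`).
[cite: Lezaud2001, Theorem 1.1 and Remark 1.2] -/
theorem integral_exp_timeIntegral_le_of_gap_of_warm (L : ℕ) [NeZero L] (β' : ℝ)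
    (κ : ℝ≥0 → Kernel (GaugeConfig 3 L (Matrix.specialUnitaryGroup (Fin 2) ℂ))
      (GaugeConfig 3 L (Matrix.specialUnitaryGroup (Fin 2) ℂ))) [∀ t, IsMarkovKernel (κ t)]
    (hreal : ∀ (t : ℝ≥0) (x : GaugeConfig 3 L (Matrix.specialUnitaryGroup (Fin 2) ℂ))
        (Ω : Type) [MeasurableSpace Ω] (P : Measure Ω) [IsProbabilityMeasure P]
        (W : ℝ≥0 → Ω → (Edge 3 L × NoiseIdx 2 → ℝ)) (hW : IsFlatBrownian W P)
        (U : ℝ≥0 → Ω → GaugeConfig 3 L (Matrix.specialUnitaryGroup (Fin 2) ℂ)),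
        (∀ ω, U 0 ω = x) →
        (latticeLangevinDynamics (fundamentalLatticeRep 2) β').IsSolution (fundamentalRep (Fin 2))
          hW.natFiltration P W U →
        κ t x = P.map (U t))
    {lam : ℝ} (hlam : 0 < lam)
    (hgap : ∀ {G : GaugeConfig 3 L (Matrix.specialUnitaryGroup (Fin 2) ℂ) → ℝ}, Measurable G → ∀ {M : ℝ}, (∀ x, |G x| ≤ M) →
      ∀ t : ℝ≥0, ∫ x, ((∫ y, G y ∂(κ t x)) - ∫ z, G z ∂(wilsonMeasure (d := 3) (L := L) (fundamentalRep (Fin 2)) β')) ^ 2 ∂(wilsonMeasure (d := 3) (L := L) (fundamentalRep (Fin 2)) β') ≤ Real.exp (-2 * lam * t) * ∫ x, (G x - ∫ z, G z ∂(wilsonMeasure (d := 3) (L := L) (fundamentalRep (Fin 2)) β')) ^ 2 ∂(wilsonMeasure (d := 3) (L := L) (fundamentalRep (Fin 2)) β'))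
    (x : GaugeConfig 3 L (Matrix.specialUnitaryGroup (Fin 2) ℂ))
    {Ω : Type} [MeasurableSpace Ω] {P : Measure Ω} [IsProbabilityMeasure P]
    {W : ℝ≥0 → Ω → (Edge 3 L × NoiseIdx 2 → ℝ)} (hW : IsFlatBrownian W P)
    {U : ℝ≥0 → Ω → GaugeConfig 3 L (Matrix.specialUnitaryGroup (Fin 2) ℂ)} (hU0 : ∀ ω, U 0 ω = x)
    (hU : (latticeLangevinDynamics (fundamentalLatticeRep 2) β').IsSolution (fundamentalRep (Fin 2)) hW.natFiltration P W U)
    (a : ℝ≥0) {D : ℝ} (hD : 0 ≤ D)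
    (hwarm : ∀ {φ : GaugeConfig 3 L (Matrix.specialUnitaryGroup (Fin 2) ℂ) → ℝ}, Measurable φ → ∀ {M : ℝ}, (∀ z, |φ z| ≤ M) →
      |∫ ω, φ (U a ω) ∂P| ≤ D * (∫ z, φ z ^ 2 ∂(wilsonMeasure (d := 3) (L := L) (fundamentalRep (Fin 2)) β')) ^ (1 / (2 : ℝ)))
    {V : GaugeConfig 3 L (Matrix.specialUnitaryGroup (Fin 2) ℂ) → ℝ} (hVc : Continuous V) {b σ : ℝ} (hb : 0 ≤ b)
    (hVb : ∀ z, |V z| ≤ b) (hσ : 0 < σ) (hV0 : ∫ z, V z ∂(wilsonMeasure (d := 3) (L := L) (fundamentalRep (Fin 2)) β') = 0) (hV2 : ∫ z, V z ^ 2 ∂(wilsonMeasure (d := 3) (L := L) (fundamentalRep (Fin 2)) β') ≤ σ ^ 2)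
    {θ : ℝ} (hθ : 0 ≤ θ) (hθb : θ * b < lam) {T : ℝ} (hT : 0 < T) :
    Integrable (fun ω => Real.exp (θ * ∫ r in Ioc 0 T, V (U (a + r.toNNReal) ω))) P ∧
    ∫ ω, Real.exp (θ * ∫ r in Ioc 0 T, V (U (a + r.toNNReal) ω)) ∂P ≤ D * Real.exp (T * (θ ^ 2 * σ ^ 2 / (lam - θ * b))) := by
  classical
  haveI := secondCountableTopology_su2
  haveI := borelSpace_config L
  have hd : 0 < lam - θ * b := by linarith
  have hVm : Measurable V := hVc.measurable
  have hmU : ∀ r : ℝ≥0, Measurable (U r) := fun r => (hU.adapted r).mono (hW.natFiltration.le r) le_rfl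
  -- the steps `h_n = T/(n+1)`
  set hN : ℕ → ℝ≥0 := fun n => T.toNNReal / ((n : ℝ≥0) + 1) with hhN
  have hNreal : ∀ n : ℕ, (hN n : ℝ) = T / ((n : ℝ) + 1) := fun n => by
    simp only [hhN, NNReal.coe_div, Real.coe_toNNReal T hT.le, NNReal.coe_add, NNReal.coe_natCast, NNReal.coe_one]
  have hNpos : ∀ n : ℕ, 0 < (hN n : ℝ) := fun n => by rw [hNreal]; positivity
  have hNT : ∀ n : ℕ, ((n : ℝ) + 1) * (hN n : ℝ) = T := fun n => by
    rw [hNreal]; field_simp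
  have hnT : ∀ n : ℕ, (n : ℝ) * (hN n : ℝ) ≤ T := fun n => by linarith [hNT n, (hNpos n).le]
  have hN0 : Tendsto (fun n => (hN n : ℝ)) atTop (𝓝 0) := by
    have h := (tendsto_one_div_add_atTop_nhds_zero_nat (𝕜 := ℝ)).const_mul T
    rw [mul_zero] at h
    refine h.congr fun n => ?_
    rw [hNreal]; ring
  -- the skeleton functionals and their limit
  set F : ℕ → Ω → ℝ := fun n ω =>
    Real.exp (θ * (hN n : ℝ) * ∑ k ∈ Finset.range (n + 1), V (U (a + (k : ℝ≥0) * hN n) ω)) with hFdef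
  set Fl : Ω → ℝ := fun ω => Real.exp (θ * ∫ r in Ioc 0 T, V (U (a + r.toNNReal) ω)) with hFldef
  have hFm : ∀ n, Measurable (F n) := fun n =>
    Real.measurable_exp.comp ((Finset.measurable_sum _ fun k _ => hVm.comp (hmU _)).const_mul _)
  have hFb : ∀ n ω, |F n ω| ≤ Real.exp (θ * (T * b)) := by
    intro n ω
    rw [hFdef]; dsimp only
    rw [abs_of_pos (Real.exp_pos _)]
    refine Real.exp_le_exp.2 ?_
    have hs : ∑ k ∈ Finset.range (n + 1), V (U (a + (k : ℝ≥0) * hN n) ω) ≤ ((n : ℝ) + 1) * b :=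
      calc ∑ k ∈ Finset.range (n + 1), V (U (a + (k : ℝ≥0) * hN n) ω)
          ≤ ∑ _k ∈ Finset.range (n + 1), b := Finset.sum_le_sum fun k _ => (le_abs_self _).trans (hVb _)
        _ = ((n : ℝ) + 1) * b := by rw [Finset.sum_const, Finset.card_range, nsmul_eq_mul]; push_cast; ring
    calc θ * (hN n : ℝ) * ∑ k ∈ Finset.range (n + 1), V (U (a + (k : ℝ≥0) * hN n) ω)
        ≤ θ * (hN n : ℝ) * (((n : ℝ) + 1) * b) := mul_le_mul_of_nonneg_left hs (mul_nonneg hθ (hNpos n).le)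
      _ = θ * ((((n : ℝ) + 1) * (hN n : ℝ)) * b) := by ring
      _ = θ * (T * b) := by rw [hNT n]
  have hlim : ∀ᵐ ω ∂P, Tendsto (fun n => F n ω) atTop (𝓝 (Fl ω)) := by
    filter_upwards [hU.continuous] with ω hω
    have hg : Continuous fun r : ℝ => V (U (a + r.toNNReal) ω) :=
      hVc.comp (hω.comp (continuous_const.add continuous_real_toNNReal))
    have hR := Literature.Analysis.Asymptotics.tendsto_mul_sum_range_intervalIntegral (l := atTop)
      (f := fun r : ℝ => V (U (a + r.toNNReal) ω)) hg hT.le (h := fun n : ℕ => (hN n : ℝ)) (N := fun n : ℕ => n + 1)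
      (tendsto_nhdsWithin_iff.2 ⟨hN0, Eventually.of_forall fun n => hNpos n⟩)
      (by
        have e : (fun n : ℕ => (((n + 1 : ℕ) : ℝ)) * (hN n : ℝ)) = fun _ => T := funext fun n => by push_cast; exact hNT n
        rw [e]; exact tendsto_const_nhds)
    rw [intervalIntegral.integral_of_le hT.le] at hR
    have hk : ∀ (n k : ℕ), a + (k : ℝ≥0) * hN n = a + ((k : ℝ) * (hN n : ℝ)).toNNReal := fun n k => by
      congr 1; apply NNReal.eq; rw [Real.coe_toNNReal _ (by positivity)]; push_cast; ring
    have e2 : ∀ n, F n ω = Real.exp (θ * ((hN n : ℝ) * ∑ k ∈ Finset.range (n + 1), V (U (a + ((k : ℝ) * (hN n : ℝ)).toNNReal) ω))) := by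
      intro n
      rw [hFdef]; dsimp only
      have hsum1 : ∑ k ∈ Finset.range (n + 1), V (U (a + (k : ℝ≥0) * hN n) ω) =
          ∑ k ∈ Finset.range (n + 1), V (U (a + ((k : ℝ) * (hN n : ℝ)).toNNReal) ω) :=
        Finset.sum_congr rfl fun k _ => by rw [hk n k]
      rw [hsum1, mul_assoc]
    have e3 : (fun n => F n ω) = fun n => Real.exp (θ * ((hN n : ℝ) *
        ∑ k ∈ Finset.range (n + 1), V (U (a + ((k : ℝ) * (hN n : ℝ)).toNNReal) ω))) := funext e2
    rw [e3, hFldef]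
    exact (Real.continuous_exp.tendsto _).comp (hR.const_mul θ)
  -- dominated convergence; measurability and integrability of the limit
  have hconv : Tendsto (fun n => ∫ ω, F n ω ∂P) atTop (𝓝 (∫ ω, Fl ω ∂P)) :=
    tendsto_integral_of_dominated_convergence (fun _ => Real.exp (θ * (T * b))) (fun n => (hFm n).aestronglyMeasurable)
      (integrable_const _) (fun n => ae_of_all _ fun ω => by rw [Real.norm_eq_abs]; exact hFb n ω) hlim
  have hFl_meas : AEStronglyMeasurable Fl P :=
    aestronglyMeasurable_of_tendsto_ae atTop (fun n => (hFm n).aestronglyMeasurable) hlim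
  have hFl_int : Integrable Fl P :=
    (integrable_const (Real.exp (θ * (T * b)))).mono' hFl_meas (by
      filter_upwards [hlim] with ω hω
      rw [Real.norm_eq_abs]
      exact le_of_tendsto' ((continuous_abs.tendsto _).comp hω) fun n => hFb n ω)
  refine ⟨hFl_int, ?_⟩
  -- the discrete bounds, eventually in `n`
  set Λ : ℝ := θ ^ 2 * σ ^ 2 / (lam - θ * b) with hΛ
  set C : ℝ := 2 * θ ^ 2 * σ ^ 2 * lam ^ 2 / (lam - θ * b) ^ 2 + θ ^ 2 * b ^ 2 + 3 * lam * θ * b with hC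
  have hΛ0 : 0 ≤ Λ := by rw [hΛ]; positivity
  have hC0 : 0 ≤ C := by rw [hC]; positivity
  set g : ℕ → ℝ := fun n => D * Real.exp (θ * (hN n : ℝ) * b) * Real.exp (T * (Λ + (hN n : ℝ) * C)) with hgdef
  have hδ : 0 < min (1 / lam) (min (1 / (θ * b + 1)) ((lam - θ * b) / (2 * lam ^ 2))) :=
    lt_min (by positivity) (lt_min (by positivity) (div_pos hd (by positivity)))
  have hev : ∀ᶠ n in atTop, ∫ ω, F n ω ∂P ≤ g n := by
    filter_upwards [hN0.eventually (gt_mem_nhds hδ)] with n hn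
    have hh := hNpos n
    have h1 : lam * (hN n : ℝ) ≤ 1 := by
      have := (lt_min_iff.1 hn).1
      rw [lt_div_iff₀ hlam] at this; linarith
    have h2 : θ * (hN n : ℝ) * b ≤ 1 := by
      have := (lt_min_iff.1 (lt_min_iff.1 hn).2).1
      rw [lt_div_iff₀ (by positivity)] at this; nlinarith [mul_nonneg hθ hb]
    have h3 : 2 * lam ^ 2 * (hN n : ℝ) ≤ lam - θ * b := by
      have := (lt_min_iff.1 (lt_min_iff.1 hn).2).2
      rw [lt_div_iff₀ (by positivity)] at this; linarith
    obtain ⟨hc, hmle⟩ := FeynmanKac.lezaud_rate_bound (σ := σ) hlam hθ hb hθb hh h1 h3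
    have hdisc := integral_exp_skeleton_sum_le L β' κ hreal hlam hgap x hW hU0 hU a hD hwarm hVm hb hVb hσ hV0 hV2 hθ (hN n) hh h2 hc n
    have hr1 : Real.exp (-(lam * (hN n : ℝ))) ≤ 1 := Real.exp_le_one_iff.2 (by nlinarith)
    have hm0 : 0 ≤ 1 + Real.exp (-(lam * (hN n : ℝ))) ^ 2 * (θ * (hN n : ℝ)) ^ 2 * σ ^ 2 /
        (1 - Real.exp (-(lam * (hN n : ℝ))) - Real.exp (-(lam * (hN n : ℝ))) * (θ * (hN n : ℝ) * b)) +
        Real.exp (-(lam * (hN n : ℝ))) * (θ * (hN n : ℝ) * b) ^ 2 + 3 * (1 - Real.exp (-(lam * (hN n : ℝ)))) * (θ * (hN n : ℝ) * b) :=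
      add_nonneg (add_nonneg (add_nonneg zero_le_one (div_nonneg (by positivity) hc.le)) (by positivity))
        (mul_nonneg (mul_nonneg (by norm_num) (sub_nonneg.2 hr1)) (by positivity))
    have hpow := pow_le_exp_of_le_one_add (n := n) hm0 hmle hΛ0 hC0 hh.le (hnT n)
    calc ∫ ω, F n ω ∂P ≤ D * Real.exp (θ * (hN n : ℝ) * b) * _ := hdisc
      _ ≤ D * Real.exp (θ * (hN n : ℝ) * b) * Real.exp (T * (Λ + (hN n : ℝ) * C)) :=
          mul_le_mul_of_nonneg_left hpow (by positivity)
  have hglim : Tendsto g atTop (𝓝 (D * Real.exp (θ * 0 * b) * Real.exp (T * (Λ + 0 * C)))) := by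
    refine (tendsto_const_nhds.mul ((Real.continuous_exp.tendsto _).comp ((hN0.const_mul θ).mul_const b))).mul
      ((Real.continuous_exp.tendsto _).comp ((tendsto_const_nhds.add (hN0.mul_const C)).const_mul T))
  simp only [mul_zero, zero_mul, Real.exp_zero, mul_one, add_zero] at hglim
  exact le_of_tendsto_of_tendsto hconv hglim hev

/-- ★★★ **LEZAUD'S BERNSTEIN TAIL FROM A GAP AND A WARM START (abstract form).**  In the setting of
`integral_exp_timeIntegral_le_of_gap_of_warm`, for every `T > 0` and `ε > 0`:
`P[ T⁻¹ ∫_{(0,T]} V(U_{a+r}) dr ≥ ε ] ≤ D · exp(−λ·T·ε² / (4σ² + 2bε))` (Markov's inequality at `θ = λε/(2σ² + bε)`).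
[cite: Lezaud2001, Theorem 1.1 and Remark 1.2] -/
theorem timeIntegral_tail_le_of_gap_of_warm (L : ℕ) [NeZero L] (β' : ℝ)
    (κ : ℝ≥0 → Kernel (GaugeConfig 3 L (Matrix.specialUnitaryGroup (Fin 2) ℂ))
      (GaugeConfig 3 L (Matrix.specialUnitaryGroup (Fin 2) ℂ))) [∀ t, IsMarkovKernel (κ t)]
    (hreal : ∀ (t : ℝ≥0) (x : GaugeConfig 3 L (Matrix.specialUnitaryGroup (Fin 2) ℂ))
        (Ω : Type) [MeasurableSpace Ω] (P : Measure Ω) [IsProbabilityMeasure P]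
        (W : ℝ≥0 → Ω → (Edge 3 L × NoiseIdx 2 → ℝ)) (hW : IsFlatBrownian W P)
        (U : ℝ≥0 → Ω → GaugeConfig 3 L (Matrix.specialUnitaryGroup (Fin 2) ℂ)),
        (∀ ω, U 0 ω = x) →
        (latticeLangevinDynamics (fundamentalLatticeRep 2) β').IsSolution (fundamentalRep (Fin 2))
          hW.natFiltration P W U →
        κ t x = P.map (U t))
    {lam : ℝ} (hlam : 0 < lam)
    (hgap : ∀ {G : GaugeConfig 3 L (Matrix.specialUnitaryGroup (Fin 2) ℂ) → ℝ}, Measurable G → ∀ {M : ℝ}, (∀ x, |G x| ≤ M) →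
      ∀ t : ℝ≥0, ∫ x, ((∫ y, G y ∂(κ t x)) - ∫ z, G z ∂(wilsonMeasure (d := 3) (L := L) (fundamentalRep (Fin 2)) β')) ^ 2 ∂(wilsonMeasure (d := 3) (L := L) (fundamentalRep (Fin 2)) β') ≤ Real.exp (-2 * lam * t) * ∫ x, (G x - ∫ z, G z ∂(wilsonMeasure (d := 3) (L := L) (fundamentalRep (Fin 2)) β')) ^ 2 ∂(wilsonMeasure (d := 3) (L := L) (fundamentalRep (Fin 2)) β'))
    (x : GaugeConfig 3 L (Matrix.specialUnitaryGroup (Fin 2) ℂ))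
    {Ω : Type} [MeasurableSpace Ω] {P : Measure Ω} [IsProbabilityMeasure P]
    {W : ℝ≥0 → Ω → (Edge 3 L × NoiseIdx 2 → ℝ)} (hW : IsFlatBrownian W P)
    {U : ℝ≥0 → Ω → GaugeConfig 3 L (Matrix.specialUnitaryGroup (Fin 2) ℂ)} (hU0 : ∀ ω, U 0 ω = x)
    (hU : (latticeLangevinDynamics (fundamentalLatticeRep 2) β').IsSolution (fundamentalRep (Fin 2)) hW.natFiltration P W U)
    (a : ℝ≥0) {D : ℝ} (hD : 0 ≤ D)
    (hwarm : ∀ {φ : GaugeConfig 3 L (Matrix.specialUnitaryGroup (Fin 2) ℂ) → ℝ}, Measurable φ → ∀ {M : ℝ}, (∀ z, |φ z| ≤ M) →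
      |∫ ω, φ (U a ω) ∂P| ≤ D * (∫ z, φ z ^ 2 ∂(wilsonMeasure (d := 3) (L := L) (fundamentalRep (Fin 2)) β')) ^ (1 / (2 : ℝ)))
    {V : GaugeConfig 3 L (Matrix.specialUnitaryGroup (Fin 2) ℂ) → ℝ} (hVc : Continuous V) {b σ : ℝ} (hb : 0 ≤ b)
    (hVb : ∀ z, |V z| ≤ b) (hσ : 0 < σ) (hV0 : ∫ z, V z ∂(wilsonMeasure (d := 3) (L := L) (fundamentalRep (Fin 2)) β') = 0) (hV2 : ∫ z, V z ^ 2 ∂(wilsonMeasure (d := 3) (L := L) (fundamentalRep (Fin 2)) β') ≤ σ ^ 2)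
    {T : ℝ} (hT : 0 < T) {ε : ℝ} (hε : 0 < ε) :
    P.real {ω | ε ≤ T⁻¹ * ∫ r in Ioc 0 T, V (U (a + r.toNNReal) ω)} ≤ D * Real.exp (-(lam * T * ε ^ 2 / (4 * σ ^ 2 + 2 * b * ε))) := by
  classical
  obtain ⟨hθ, hθb, hexp⟩ := lezaud_bernstein_exponent (T := T) hlam hb hσ hε
  set θ : ℝ := lam * ε / (2 * σ ^ 2 + b * ε) with hθdef
  obtain ⟨hFl_int, hmgf⟩ := integral_exp_timeIntegral_le_of_gap_of_warm L β' κ hreal hlam hgap x hW hU0 hU a hD hwarm hVc hb hVb hσ hV0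
    hV2 hθ hθb hT
  set Fl : Ω → ℝ := fun ω => Real.exp (θ * ∫ r in Ioc 0 T, V (U (a + r.toNNReal) ω)) with hFldef
  have hsub : {ω | ε ≤ T⁻¹ * ∫ r in Ioc 0 T, V (U (a + r.toNNReal) ω)} ⊆ {ω | Real.exp (θ * T * ε) ≤ Fl ω} := by
    intro ω hω
    simp only [Set.mem_setOf_eq] at hω ⊢
    rw [hFldef]
    refine Real.exp_le_exp.2 ?_
    have h1 : T * ε ≤ ∫ r in Ioc 0 T, V (U (a + r.toNNReal) ω) := by
      have := mul_le_mul_of_nonneg_left hω hT.le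
      rwa [← mul_assoc, mul_inv_cancel₀ hT.ne', one_mul] at this
    calc θ * T * ε = θ * (T * ε) := by ring
      _ ≤ θ * ∫ r in Ioc 0 T, V (U (a + r.toNNReal) ω) := mul_le_mul_of_nonneg_left h1 hθ
  have hmarkov := mul_meas_ge_le_integral_of_nonneg (μ := P) (ae_of_all _ fun ω => (Real.exp_pos _).le) hFl_int (Real.exp (θ * T * ε))
  have hexp0 : 0 < Real.exp (θ * T * ε) := Real.exp_pos _
  calc P.real {ω | ε ≤ T⁻¹ * ∫ r in Ioc 0 T, V (U (a + r.toNNReal) ω)}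
      ≤ P.real {ω | Real.exp (θ * T * ε) ≤ Fl ω} := measureReal_mono hsub
    _ ≤ (∫ ω, Fl ω ∂P) / Real.exp (θ * T * ε) := by rw [le_div_iff₀ hexp0, mul_comm]; exact hmarkov
    _ ≤ D * Real.exp (T * (θ ^ 2 * σ ^ 2 / (lam - θ * b))) / Real.exp (θ * T * ε) := div_le_div_of_nonneg_right hmgf hexp0.le
    _ = D * Real.exp (T * (θ ^ 2 * σ ^ 2 / (lam - θ * b)) - θ * T * ε) := by rw [mul_div_assoc, ← Real.exp_sub]
    _ = D * Real.exp (-(lam * T * ε ^ 2 / (4 * σ ^ 2 + 2 * b * ε))) := by rw [hexp]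

end Summit.QuantumFields.YangMills.Theorems.ColdStartUniversality

end
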